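import Literature.MathematicalPhysics.QuantumFieldTheory.BalabanImbrieJaffe1984to88.BIJ88ObservableFactorization312
import Literature.Probability.LatticeModels.ClusterExpansionKPBound

/-!
# `BalabanImbrieJaffe1984to88.BIJ88GkEstimate312` — T. Bałaban, J. Imbrie, A. Jaffe, *Effective action and cluster properties of the abelian
Higgs model*, Commun. Math. Phys. **114** (1988) 257–315 [BalabanImbrieJaffe1988]: Sect. 5.14, p. 312 [PDF 56] — **the estimate of `G_k(X_{r′})`
AT THE LEVEL OF THE POLYMER GAS**, for the `G_k` DEFINED in this seat's gen-11 `BIJ88ObservableFactorization312.Gk`.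

p. 312 [PDF 56], verbatim: *"The main source of concern in estimating G_k(X_{r′}) is that we only have bounds |F_{k,loc}(X_{σ₁})| ≤
c(L^kε)^{−m(c)}e^{−m′(c)} coming from our estimates on perturbation expansions of observables … By performing sufficiently many integrations by
parts, we have arranged for enough small factors to beat these large factors in the remainder terms … These considerations lead to the following
estimate: |G_k(X)| ≤ c(F(X)) (e^β(L^kε/ε₀)^{1/4−α})^{β′|X∖∪X_c|} Π_{X_{σ₁}⊂X: dist(X_{σ₁},Λ^{(k)c}_{12}) < r(e_k)} [c(L^kε)^{−m(c)}e^{−m′(c)}]."*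

HONEST FRAMING (cell `lit-balaban`, verbatim): statement-level skeleton of published theorems with citation tags; proofs where landed; nothing here is a claim about the Yang–Mills mass gap.

PDF held: `paper:balaban1988-cmp114-bij-abelian-higgs-effective-action` (journal page = PDF page + 256); p. 312 = PDF 56 (`p0056.txt` L14–31), read
this session.

WHAT IS REPRODUCED (unit `lit-balaban-p25`, generation 12 of the Phase-2 proof seat p25; SKELETON row `C2.Claim@312`, whose head is the typed leaf
`BIJ88Sect5StatementsPart4.Ineq312`; HOME `run/shared/lean/pub/lit-balaban/lit-balaban-p25/`). The gen-11 setting: vacuum polymers `Λ : Finset P`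
with supports `supp`, activities `w`, incompatibility `inc` (a KP gas); decorated (observable-carrying) polymers `𝒬` with supports `suppQ`, activities
`wQ`, carrying the observables `obs X ⊆ Rset` located by `loc`; `G_k(X′) = Σ_{K} Π_{X∈K.toLeft} wQ X · Π_{S∈K.toRight} m(S)` over the overlap-connected
admissible sets `K` of items filling `X′`, `m(S) = e^{−Ψ(S)} − 1`, `Ψ(S) = Σ_{C⊆Λ: supp C = S} Φ^T(C)`. THE SHAPE OF THE PRINTED ESTIMATE, at gas
level: the observable factors `c(F(X))` ↔ `Π_{X∈D}‖wQ X‖` summed over the admissible decorated families `D` inside `X′`; the small factor per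
cube of `X ∖ ∪X_c` ↔ `e^{−λ}` per genuine cube of `X′` not covered by a decorated polymer; the combinatoric factor ↔ `e^{η#T}` (`T` = the genuine
cubes of `X′`: all of `X′` for plain cube polymers, the `inl`-cubes for the virtual supports of gens 9/11).
* §1 **`sum_covers_le`** (generic, the Mayer-cover bound): for nonnegative weights `v` on a finite family `𝒮` of finite sets with
  `Σ_{S∈𝒮, S∋x} v_S e^{λ#(S∩T)} ≤ 1` for the points `x` of `R ⊆ T` (`λ ≥ 0`), `Σ_{𝒯⊆𝒮 covering R} Π_{S∈𝒯} v_S ≤ Π_{S∈𝒮}(1+v_S) · e^{−λ#R}` — induction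
  on `R`: a cover contains a set through any given point.
* §2 **`norm_Gk_le_sum_decorated`** (structural): `‖G_k(X′)‖ ≤ Σ_{D} (Π_{X∈D}‖wQ X‖) · Σ_{𝒯 ⊆ 𝒮(X′) covering X′∖dsupp D} Π_{S∈𝒯}‖m(S)‖`, `D` over
  the admissible decorated families in `X′` (pairwise disjoint supports inside `X′`, carrying exactly the observables located in `X′`), `𝒮(X′)` =
  the Mayer support sets inside `X′` — the map `K ↦ (K.toLeft, K.toRight)` (connectedness and the direct-overlap clause dropped, an upper bound).
* §3 **`norm_Gk_le_of_mayer_bound`**: with a set `T` of "genuine" points met by every Mayer support set inside `X′` (for plain cube polymers `T = X′`;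
  for the virtual supports of gen 9/11 the genuine cubes) and `Σ_{S∈𝒮(X′), S∋x}‖m(S)‖e^{λ#(S∩T)} ≤ η ≤ 1` for `x ∈ T`:
  `‖G_k(X′)‖ ≤ e^{η#T} · Σ_D (Π_{X∈D}‖wQ X‖) e^{−λ#((X′∖dsupp D)∩T)}` (§1 + `Π(1+v) ≤ e^{Σv}`).
* §4 FROM THE CLUSTERS: `norm_mayer_le` (`‖m(S)‖ ≤ 2‖Ψ(S)‖` when `‖Ψ(S)‖ ≤ 1`, Mathlib `Complex.norm_exp_sub_one_le`), `norm_suppWeight_le`,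
  **`mayer_pinned_bound_of_clusters`**: the pinned cluster bound `Σ_{C⊆Λ: x∈supp C}‖Φ^T(C)‖e^{λ#(supp C∩T)} ≤ η/2` (`η ≤ 1`) gives the hypothesis of §3;
  **`norm_Gk_le_of_cluster_bound`**.
* §5 FROM THE KOTECKÝ–PREISS ESTIMATE (4) (the tree's DISCHARGED named fact `LatticeModels.koteckyPreiss_truncatedWeight_bound_holds`, [KP86] Theorem
  p. 492): **`cluster_pinned_bound_of_kp`** — the KP hypothesis (1) with size functions `a`, `d ≥ λ#(supp∩T)` over the volume `Λ` and a *pinning polymer*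
  `σ_x` at each cube (`a(σ_x) ≤ η/2`, every polymer of `Λ` through `x` incompatible with `σ_x`; for cube polymers: the one-cube polymer `{x}`) give the
  pinned cluster bound; and the END-TO-END gas-level estimate **`norm_Gk_le_of_kp`**.
HONEST SCOPE: (a) this is the COMBINATORIAL HALF of the printed estimate — the activity bounds (`‖wQ X‖`, i.e. the printed `c(L^kε)^{−m(c)}e^{−m′(c)}`
and the small factors from the integrations by parts; the KP smallness of the vacuum activities = (5.14.4) + p. 310 *"standard exercise"*, gen 12's
`BIJ88Expansion5143KP`) are HYPOTHESES; (b) the boundary refinement (*"Near the boundary … proximity to Λ^{(k)c}_{11}"*) is not modelled; (c) the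
constants (`e^{η#T}`, `e^{−λ}` per uncovered genuine cube) are not the printed ones and are not optimized; (d) the typed leaf `Ineq312` is NOT asserted.
0 `sorry`, 0 new `Prop` facts (D-0026); theorems only; imports `BIJ88ObservableFactorization312` and `LatticeModels.ClusterExpansionKPBound`;
modifies nothing. NOT summit progress; NOT
continuum; NOT Clay. Cell `lit-balaban` Phase 2, seat p25 gen 12 (row owner r16, referee ref-5).
-/

noncomputable section

open Finset
open Literature.Probability.LatticeModels
open Literature.MathematicalPhysics.QuantumFieldTheory.BalabanImbrieJaffe1984to88.BIJ88ObservableGas312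
open Literature.MathematicalPhysics.QuantumFieldTheory.BalabanImbrieJaffe1984to88.BIJ88ClusterSupports312
open Literature.MathematicalPhysics.QuantumFieldTheory.BalabanImbrieJaffe1984to88.BIJ88SupportRegrouping312
open Literature.MathematicalPhysics.QuantumFieldTheory.BalabanImbrieJaffe1984to88.BIJ88ObservableFactorization312

namespace Literature.MathematicalPhysics.QuantumFieldTheory.BalabanImbrieJaffe1984to88.BIJ88GkEstimate312

/-! ## §1 The Mayer-cover bound -/

section Covers

variable {ι : Type*} [DecidableEq ι]

/-- **THE MAYER-COVER BOUND**: for nonnegative weights `v` on a finite family `𝒮` of finite sets such that `Σ_{S∈𝒮, S∋x} v_S e^{λ#(S∩T)} ≤ 1` for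
every point `x` of `R ⊆ T` (`λ ≥ 0`; `T` = the points whose count carries the smallness, e.g. the genuine cubes among virtual ones), the total weight
of the subfamilies of `𝒮` COVERING `R` is at most `Π_{S∈𝒮}(1 + v_S) · e^{−λ#R}` — a small factor `e^{−λ}` per covered point (p. 312: *"enough small
factors"* per cube of `X ∖ ∪X_c`; p. 307: the combinatoric factors `exp(…|X|)`). Induction on `R`: every cover contains a set through a chosen
point `x ∈ R`, and the rest covers `R ∖ S`. [cite: BalabanImbrieJaffe1988, p.312 (Sect. 5.14)] -/
theorem sum_covers_le (𝒮 : Finset (Finset ι)) {v : Finset ι → ℝ} (hv : ∀ S ∈ 𝒮, 0 ≤ v S) {lam : ℝ} (hlam : 0 ≤ lam) (T : Finset ι)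
    (R : Finset ι) (hRT : R ⊆ T) (hx : ∀ x ∈ R, ∑ S ∈ 𝒮 with x ∈ S, v S * Real.exp (lam * (S ∩ T).card) ≤ 1) :
    ∑ 𝒯 ∈ 𝒮.powerset with R ⊆ 𝒯.biUnion id, ∏ S ∈ 𝒯, v S ≤ (∏ S ∈ 𝒮, (1 + v S)) * Real.exp (-(lam * R.card)) := by
  induction R using Finset.strongInduction with
  | H R ih =>
    set E : ℝ := ∏ S ∈ 𝒮, (1 + v S) with hE
    have hE0 : 0 ≤ E := prod_nonneg fun S hS => by linarith [hv S hS]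
    have hPnn : ∀ 𝒯 ∈ 𝒮.powerset, 0 ≤ ∏ S ∈ 𝒯, v S := fun 𝒯 h𝒯 =>
      prod_nonneg fun S hS => hv S (mem_powerset.1 h𝒯 hS)
    rcases R.eq_empty_or_nonempty with rfl | ⟨x, hxR⟩
    · -- no point to cover: the unconstrained sum `Π (1 + v)`
      rw [card_empty, Nat.cast_zero, mul_zero, neg_zero, Real.exp_zero, mul_one, hE, prod_one_add]
      exact sum_le_sum_of_subset_of_nonneg (filter_subset _ _) fun 𝒯 h𝒯 _ => hPnn 𝒯 h𝒯
    · -- a cover contains some `S ∋ x`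
      have hxS : ∀ 𝒯 ∈ 𝒮.powerset.filter (fun 𝒯 => R ⊆ 𝒯.biUnion id), ∃ S ∈ 𝒯, x ∈ S := by
        intro 𝒯 h𝒯
        obtain ⟨-, hcov⟩ := mem_filter.1 h𝒯
        simpa only [mem_biUnion, id] using hcov hxR
      calc ∑ 𝒯 ∈ 𝒮.powerset with R ⊆ 𝒯.biUnion id, ∏ S ∈ 𝒯, v S
          ≤ ∑ 𝒯 ∈ 𝒮.powerset with R ⊆ 𝒯.biUnion id, ∑ S ∈ 𝒯 with x ∈ S, ∏ S' ∈ 𝒯, v S' := by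
            refine sum_le_sum fun 𝒯 h𝒯 => ?_
            obtain ⟨S, hS, hxS'⟩ := hxS 𝒯 h𝒯
            have hmem : S ∈ 𝒯.filter (fun S => x ∈ S) := mem_filter.2 ⟨hS, hxS'⟩
            calc ∏ S' ∈ 𝒯, v S' = ∑ S'' ∈ ({S} : Finset (Finset ι)), ∏ S' ∈ 𝒯, v S' := by rw [sum_singleton]
              _ ≤ ∑ S ∈ 𝒯 with x ∈ S, ∏ S' ∈ 𝒯, v S' :=
                sum_le_sum_of_subset_of_nonneg (singleton_subset_iff.2 hmem) fun _ _ _ => hPnn 𝒯 (mem_filter.1 h𝒯).1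
        _ = ∑ S ∈ 𝒮 with x ∈ S, ∑ 𝒯 ∈ (𝒮.powerset.filter fun 𝒯 => R ⊆ 𝒯.biUnion id) with S ∈ 𝒯, ∏ S' ∈ 𝒯, v S' := by
            rw [sum_comm' (t' := 𝒮.filter fun S => x ∈ S)
              (s' := fun S => (𝒮.powerset.filter fun 𝒯 => R ⊆ 𝒯.biUnion id).filter fun 𝒯 => S ∈ 𝒯)]
            intro 𝒯 S
            simp only [mem_filter, mem_powerset]
            constructor
            · rintro ⟨⟨h𝒯, hcov⟩, hS, hxS⟩
              exact ⟨⟨⟨h𝒯, hcov⟩, hS⟩, h𝒯 hS, hxS⟩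
            · rintro ⟨⟨⟨h𝒯, hcov⟩, hS⟩, -, hxS⟩
              exact ⟨⟨h𝒯, hcov⟩, hS, hxS⟩
        _ ≤ ∑ S ∈ 𝒮 with x ∈ S, v S * (E * Real.exp (-(lam * (R \ S).card))) := by
            refine sum_le_sum fun S hS => ?_
            obtain ⟨hS𝒮, hxS'⟩ := mem_filter.1 hS
            -- `𝒯 ↦ 𝒯.erase S` into the covers of `R ∖ S`
            have hsplit : ∀ 𝒯 ∈ (𝒮.powerset.filter fun 𝒯 => R ⊆ 𝒯.biUnion id).filter (fun 𝒯 => S ∈ 𝒯),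
                ∏ S' ∈ 𝒯, v S' = v S * ∏ S' ∈ 𝒯.erase S, v S' := fun 𝒯 h𝒯 =>
              (mul_prod_erase 𝒯 v (mem_filter.1 h𝒯).2).symm
            rw [sum_congr rfl hsplit, ← mul_sum]
            refine mul_le_mul_of_nonneg_left ?_ (hv S hS𝒮)
            have himg : ((𝒮.powerset.filter fun 𝒯 => R ⊆ 𝒯.biUnion id).filter (fun 𝒯 => S ∈ 𝒯)).image (fun 𝒯 => 𝒯.erase S)
                ⊆ 𝒮.powerset.filter fun 𝒯' => R \ S ⊆ 𝒯'.biUnion id := by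
              intro 𝒯' h𝒯'
              obtain ⟨𝒯, h𝒯, rfl⟩ := mem_image.1 h𝒯'
              obtain ⟨h𝒯, hS𝒯⟩ := mem_filter.1 h𝒯
              obtain ⟨h𝒯𝒮, hcov⟩ := mem_filter.1 h𝒯
              refine mem_filter.2 ⟨mem_powerset.2 ((erase_subset _ _).trans (mem_powerset.1 h𝒯𝒮)), fun y hy => ?_⟩
              obtain ⟨hyR, hyS⟩ := mem_sdiff.1 hy
              obtain ⟨S', hS', hyS'⟩ := mem_biUnion.1 (hcov hyR)
              refine mem_biUnion.2 ⟨S', mem_erase.2 ⟨?_, hS'⟩, hyS'⟩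
              rintro rfl
              exact hyS hyS'
            have hinj : Set.InjOn (fun 𝒯 : Finset (Finset ι) => 𝒯.erase S)
                (((𝒮.powerset.filter fun 𝒯 => R ⊆ 𝒯.biUnion id).filter (fun 𝒯 => S ∈ 𝒯) : Finset (Finset (Finset ι))) :
                  Set (Finset (Finset ι))) := by
              intro 𝒯₁ h₁ 𝒯₂ h₂ h
              have hS₁ : S ∈ 𝒯₁ := (mem_filter.1 (mem_coe.1 h₁)).2
              have hS₂ : S ∈ 𝒯₂ := (mem_filter.1 (mem_coe.1 h₂)).2
              rw [← insert_erase hS₁, ← insert_erase hS₂]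
              exact congrArg _ h
            calc ∑ 𝒯 ∈ (𝒮.powerset.filter fun 𝒯 => R ⊆ 𝒯.biUnion id) with S ∈ 𝒯, ∏ S' ∈ 𝒯.erase S, v S'
                = ∑ 𝒯' ∈ ((𝒮.powerset.filter fun 𝒯 => R ⊆ 𝒯.biUnion id).filter (fun 𝒯 => S ∈ 𝒯)).image
                    (fun 𝒯 => 𝒯.erase S), ∏ S' ∈ 𝒯', v S' := by rw [sum_image hinj]
              _ ≤ ∑ 𝒯' ∈ 𝒮.powerset with R \ S ⊆ 𝒯'.biUnion id, ∏ S' ∈ 𝒯', v S' :=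
                  sum_le_sum_of_subset_of_nonneg himg fun 𝒯' h𝒯' _ => hPnn 𝒯' (mem_filter.1 h𝒯').1
              _ ≤ E * Real.exp (-(lam * (R \ S).card)) := by
                  refine ih (R \ S) ?_ (sdiff_subset.trans hRT) fun y hy => hx y (mem_sdiff.1 hy).1
                  exact Finset.ssubset_iff_subset_ne.2 ⟨sdiff_subset, fun h => (mem_sdiff.1 (h.symm ▸ hxR)).2 hxS'⟩
        _ ≤ ∑ S ∈ 𝒮 with x ∈ S, v S * (E * (Real.exp (-(lam * R.card)) * Real.exp (lam * (S ∩ T).card))) := by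
            refine sum_le_sum fun S hS => mul_le_mul_of_nonneg_left (mul_le_mul_of_nonneg_left ?_ hE0) (hv S (mem_filter.1 hS).1)
            rw [← Real.exp_add]
            refine Real.exp_le_exp.2 ?_
            have h1 : ((R \ S).card : ℝ) + (R ∩ S).card = R.card := by exact_mod_cast card_sdiff_add_card_inter R S
            have h2 : ((R ∩ S).card : ℝ) ≤ (S ∩ T).card := by
              exact_mod_cast card_le_card fun y hy => mem_inter.2 ⟨(mem_inter.1 hy).2, hRT (mem_inter.1 hy).1⟩
            nlinarith
        _ = E * Real.exp (-(lam * R.card)) * ∑ S ∈ 𝒮 with x ∈ S, v S * Real.exp (lam * (S ∩ T).card) := by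
            rw [mul_sum]
            exact sum_congr rfl fun S _ => by ring
        _ ≤ E * Real.exp (-(lam * R.card)) * 1 := by gcongr; exact hx x hxR
        _ = E * Real.exp (-(lam * R.card)) := mul_one _

omit [DecidableEq ι] in
/-- `Π_{S∈𝒮}(1 + v_S) ≤ exp(Σ_{S∈𝒮} v_S)` for `v ≥ 0`. [cite: BalabanImbrieJaffe1988, p.312 (Sect. 5.14)] -/
theorem prod_one_add_le_exp_sum (𝒮 : Finset (Finset ι)) {v : Finset ι → ℝ} (hv : ∀ S ∈ 𝒮, 0 ≤ v S) :
    ∏ S ∈ 𝒮, (1 + v S) ≤ Real.exp (∑ S ∈ 𝒮, v S) := by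
  rw [Real.exp_sum]
  exact prod_le_prod (fun S hS => by linarith [hv S hS]) fun S _ => by linarith [Real.add_one_le_exp (v S)]

/-- the total weight of a family of sets each meeting `T` is at most the sum of its pinned weights over the points of `T`.
[cite: BalabanImbrieJaffe1988, p.312 (Sect. 5.14)] -/
theorem sum_le_sum_pinned (𝒮 : Finset (Finset ι)) {v : Finset ι → ℝ} (hv : ∀ S ∈ 𝒮, 0 ≤ v S) (T : Finset ι)
    (h𝒮 : ∀ S ∈ 𝒮, (S ∩ T).Nonempty) : ∑ S ∈ 𝒮, v S ≤ ∑ x ∈ T, ∑ S ∈ 𝒮 with x ∈ S, v S := by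
  calc ∑ S ∈ 𝒮, v S ≤ ∑ S ∈ 𝒮, ∑ x ∈ T with x ∈ S, v S := by
        refine sum_le_sum fun S hS => ?_
        obtain ⟨y, hy⟩ := h𝒮 S hS
        have hmem : y ∈ T.filter (fun x => x ∈ S) := mem_filter.2 ⟨(mem_inter.1 hy).2, (mem_inter.1 hy).1⟩
        calc v S = ∑ x ∈ ({y} : Finset ι), v S := by rw [sum_singleton]
          _ ≤ ∑ x ∈ T with x ∈ S, v S := sum_le_sum_of_subset_of_nonneg (singleton_subset_iff.2 hmem) fun _ _ _ => hv S hS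
    _ = ∑ x ∈ T, ∑ S ∈ 𝒮 with x ∈ S, v S := by
        rw [sum_comm' (t' := T) (s' := fun x => 𝒮.filter fun S => x ∈ S)]
        intro S x
        simp only [mem_filter]
        tauto

end Covers

/-! ## §2 The structural bound: `K ↦ (K.toLeft, K.toRight)` -/

section Structural

variable {ι : Type*} [DecidableEq ι] {P : Type*} [DecidableEq P] {Q : Type*} [DecidableEq Q] {σ : Type*} [DecidableEq σ]
variable {supp : P → Finset ι} {suppQ : Q → Finset ι} {obs : Q → Finset σ} {loc : σ → Finset ι} {Rset : Finset σ}
  {𝒬 : Finset Q} {Λ : Finset P}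

omit [DecidableEq Q] in
/-- the product of the item weights of a set of items splits into its decorated part and its Mayer part (in norm).
[cite: BalabanImbrieJaffe1988, (5.14.5) p.312] -/
theorem prod_norm_itemWeight_eq (wQ : Q → ℂ) (inc : P → P → Prop) [DecidableRel inc] (w : P → ℂ) (K : Finset (Q ⊕ Finset ι)) :
    ∏ v ∈ K, ‖itemWeight supp wQ inc w Λ v‖ = (∏ X ∈ K.toLeft, ‖wQ X‖) * ∏ S ∈ K.toRight, ‖mayer supp inc w Λ S‖ := by
  conv_lhs => rw [← toLeft_disjSum_toRight (u := K)]
  rw [prod_disjSum]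
  rfl

/-- **THE STRUCTURAL BOUND ON `G_k(X′)`** (p. 312): the norm of the aggregate activity is at most the sum, over the ADMISSIBLE DECORATED FAMILIES `D`
inside `X′` (decorated polymers of `𝒬` with pairwise disjoint supports inside `X′`, carrying exactly the observables located in `X′`) of
`Π_{X∈D}‖wQ X‖` times the total Mayer weight `Σ_{𝒯} Π_{S∈𝒯}‖m(S)‖` of the families `𝒯` of Mayer support sets inside `X′` COVERING `X′ ∖ dsupp D`
(every cube of the aggregate not in a decorated polymer lies in a Mayer support set) — the injection `K ↦ (K.toLeft, K.toRight)`, the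
connectedness of `K` and the direct-overlap clause being dropped (an upper bound). [cite: BalabanImbrieJaffe1988, (5.14.5) p.312] -/
theorem norm_Gk_le_sum_decorated (wQ : Q → ℂ) (inc : P → P → Prop) [DecidableRel inc] (w : P → ℂ) (X' : Finset ι) :
    ‖Gk supp suppQ obs loc Rset 𝒬 wQ inc w Λ X'‖ ≤
      ∑ D ∈ 𝒬.powerset with ((∀ X ∈ D, ∀ X₂ ∈ D, X ≠ X₂ → Disjoint (suppQ X) (suppQ X₂)) ∧ D.biUnion obs = obsIn loc Rset X' ∧
          dsupp suppQ D ⊆ X'),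
        (∏ X ∈ D, ‖wQ X‖) *
          ∑ 𝒯 ∈ ((suppSets supp Λ).filter fun S => S ⊆ X').powerset with X' \ dsupp suppQ D ⊆ 𝒯.biUnion id,
            ∏ S ∈ 𝒯, ‖mayer supp inc w Λ S‖ := by
  classical
  -- abbreviations
  set DD : Finset (Finset Q) := 𝒬.powerset.filter fun D => (∀ X ∈ D, ∀ X₂ ∈ D, X ≠ X₂ → Disjoint (suppQ X) (suppQ X₂)) ∧
    D.biUnion obs = obsIn loc Rset X' ∧ dsupp suppQ D ⊆ X' with hDD
  set 𝒮' : Finset (Finset ι) := (suppSets supp Λ).filter fun S => S ⊆ X' with h𝒮'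
  set g : Finset Q × Finset (Finset ι) → ℝ := fun p => (∏ X ∈ p.1, ‖wQ X‖) * ∏ S ∈ p.2, ‖mayer supp inc w Λ S‖ with hg
  set B : Finset (Finset Q × Finset (Finset ι)) :=
    (DD ×ˢ 𝒮'.powerset).filter fun p => X' \ dsupp suppQ p.1 ⊆ p.2.biUnion id with hB
  have hg0 : ∀ p, 0 ≤ g p := fun p => mul_nonneg (prod_nonneg fun _ _ => norm_nonneg _) (prod_nonneg fun _ _ => norm_nonneg _)
  -- the right side is the sum of `g` over `B`
  have hrhs : ∑ p ∈ B, g p = ∑ D ∈ DD, (∏ X ∈ D, ‖wQ X‖) * ∑ 𝒯 ∈ 𝒮'.powerset with X' \ dsupp suppQ D ⊆ 𝒯.biUnion id,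
      ∏ S ∈ 𝒯, ‖mayer supp inc w Λ S‖ := by
    have h1 : ∑ p ∈ B, g p = ∑ p ∈ DD ×ˢ 𝒮'.powerset, if X' \ dsupp suppQ p.1 ⊆ p.2.biUnion id then g p else 0 :=
      sum_filter _ _
    rw [h1, sum_product]
    refine sum_congr rfl fun D _ => ?_
    have h2 : ∑ 𝒯 ∈ 𝒮'.powerset with X' \ dsupp suppQ D ⊆ 𝒯.biUnion id, ∏ S ∈ 𝒯, ‖mayer supp inc w Λ S‖ =
        ∑ 𝒯 ∈ 𝒮'.powerset, if X' \ dsupp suppQ D ⊆ 𝒯.biUnion id then ∏ S ∈ 𝒯, ‖mayer supp inc w Λ S‖ else 0 := sum_filter _ _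
    rw [h2, mul_sum]
    refine sum_congr rfl fun 𝒯 _ => ?_
    split_ifs <;> simp [hg]
  rw [← hrhs]
  -- the map `K ↦ (K.toLeft, K.toRight)` on the aggregate fibre
  set A := aggFiber (isuppO suppQ) (itemU supp 𝒬 Λ) (AdmLoc suppQ obs loc Rset) X' with hA
  have hφ : ∀ K ∈ A, (K.toLeft, K.toRight) ∈ B := by
    intro K hK
    obtain ⟨hKU, -, hadm, hsupp⟩ := mem_aggFiber.1 hK
    obtain ⟨hpd, hmeet, hcov⟩ := hadm
    have hKU' := subset_disjSum.1 (by unfold itemU at hKU; exact hKU)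
    have hsuppX : ∀ v ∈ K, isuppO suppQ v ⊆ X' := fun v hv => hsupp ▸ isupp_subset_asupp hv
    have hdsupp : dsupp suppQ K.toLeft ⊆ X' := by
      intro i hi
      obtain ⟨X, hX, hiX⟩ := mem_dsupp.1 hi
      exact hsuppX _ (mem_toLeft.1 hX) (by simpa using hiX)
    refine mem_filter.2 ⟨mem_product.2 ⟨mem_filter.2 ⟨mem_powerset.2 hKU'.1, hpd, hsupp ▸ hcov, hdsupp⟩,
      mem_powerset.2 fun S hS => mem_filter.2 ⟨hKU'.2 hS, ?_⟩⟩, fun y hy => ?_⟩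
    · exact hsuppX _ (mem_toRight.1 hS)
    · obtain ⟨hyX, hyD⟩ := mem_sdiff.1 hy
      rw [← hsupp] at hyX
      obtain ⟨v, hv, hyv⟩ := mem_asupp.1 hyX
      rcases v with X | S
      · exact absurd (mem_dsupp.2 ⟨X, mem_toLeft.2 hv, by simpa using hyv⟩) hyD
      · exact mem_biUnion.2 ⟨S, mem_toRight.2 hv, by simpa using hyv⟩
  have hinj : Set.InjOn (fun K : Finset (Q ⊕ Finset ι) => (K.toLeft, K.toRight)) (A : Set (Finset (Q ⊕ Finset ι))) := by
    intro K₁ _ K₂ _ h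
    obtain ⟨h1, h2⟩ := Prod.mk.inj h
    rw [← toLeft_disjSum_toRight (u := K₁), ← toLeft_disjSum_toRight (u := K₂), h1, h2]
  calc ‖Gk supp suppQ obs loc Rset 𝒬 wQ inc w Λ X'‖
      ≤ ∑ K ∈ A, ‖∏ v ∈ K, itemWeight supp wQ inc w Λ v‖ := norm_sum_le _ _
    _ = ∑ K ∈ A, g (K.toLeft, K.toRight) := by
        refine sum_congr rfl fun K _ => ?_
        rw [norm_prod, prod_norm_itemWeight_eq]
    _ = ∑ p ∈ A.image fun K => (K.toLeft, K.toRight), g p := by rw [sum_image hinj]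
    _ ≤ ∑ p ∈ B, g p := sum_le_sum_of_subset_of_nonneg (fun p hp => by
        obtain ⟨K, hK, rfl⟩ := mem_image.1 hp; exact hφ K hK) fun p _ _ => hg0 p

end Structural

/-! ## §3 The estimate from a pinned bound on the Mayer factors -/

section MayerBound

variable {ι : Type*} [DecidableEq ι] {P : Type*} [DecidableEq P] {Q : Type*} [DecidableEq Q] {σ : Type*} [DecidableEq σ]
variable {supp : P → Finset ι} {suppQ : Q → Finset ι} {obs : Q → Finset σ} {loc : σ → Finset ι} {Rset : Finset σ}
  {𝒬 : Finset Q} {Λ : Finset P}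

/-- **`|G_k(X′)| ≤ e^{η#T} · Σ_D (Π_{X∈D}‖wQ X‖) · e^{−λ#((X′∖dsupp D)∩T)}`** — THE PRINTED SHAPE AT GAS LEVEL (p. 312: observable factors × a small
factor per genuine cube not covered by an observable-carrying polymer × a combinatoric factor exponential in the size): whenever every Mayer support set
inside `X′` meets the set `T` of genuine cubes and the Mayer factors obey the pinned bound `Σ_{S∋x}‖m(S)‖e^{λ#(S∩T)} ≤ η ≤ 1` at every `x ∈ T` (`λ ≥ 0`;
for plain cube polymers `T = X′`; for the virtual supports of `BIJ88VirtualSupports310` `T` = the genuine cubes). [cite: BalabanImbrieJaffe1988, (5.14.5) p.312] -/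
theorem norm_Gk_le_of_mayer_bound (wQ : Q → ℂ) (inc : P → P → Prop) [DecidableRel inc] (w : P → ℂ) (X' T : Finset ι) {lam η : ℝ}
    (hlam : 0 ≤ lam) (hη1 : η ≤ 1) (hT : ∀ S ∈ suppSets supp Λ, S ⊆ X' → (S ∩ T).Nonempty)
    (hm : ∀ x ∈ T, ∑ S ∈ ((suppSets supp Λ).filter fun S => S ⊆ X') with x ∈ S,
      ‖mayer supp inc w Λ S‖ * Real.exp (lam * (S ∩ T).card) ≤ η) :
    ‖Gk supp suppQ obs loc Rset 𝒬 wQ inc w Λ X'‖ ≤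
      Real.exp (η * T.card) *
        ∑ D ∈ 𝒬.powerset with ((∀ X ∈ D, ∀ X₂ ∈ D, X ≠ X₂ → Disjoint (suppQ X) (suppQ X₂)) ∧ D.biUnion obs = obsIn loc Rset X' ∧
            dsupp suppQ D ⊆ X'),
          (∏ X ∈ D, ‖wQ X‖) * Real.exp (-(lam * ((X' \ dsupp suppQ D) ∩ T).card)) := by
  set 𝒮' : Finset (Finset ι) := (suppSets supp Λ).filter fun S => S ⊆ X' with h𝒮'
  have hv : ∀ S ∈ 𝒮', 0 ≤ ‖mayer supp inc w Λ S‖ := fun _ _ => norm_nonneg _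
  have h𝒮'T : ∀ S ∈ 𝒮', (S ∩ T).Nonempty := fun S hS => hT S (mem_filter.1 hS).1 (mem_filter.1 hS).2
  -- the pinned bound without the exponential weight
  have hm0 : ∀ x ∈ T, ∑ S ∈ 𝒮' with x ∈ S, ‖mayer supp inc w Λ S‖ ≤ η := fun x hx =>
    le_trans (sum_le_sum fun S _ => le_mul_of_one_le_right (norm_nonneg _)
      (Real.one_le_exp (mul_nonneg hlam (Nat.cast_nonneg _)))) (hm x hx)
  -- the unconstrained Mayer sum: `Π_{S∈𝒮'}(1 + ‖m S‖) ≤ e^{η#T}`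
  have hE : ∏ S ∈ 𝒮', (1 + ‖mayer supp inc w Λ S‖) ≤ Real.exp (η * T.card) := by
    refine (prod_one_add_le_exp_sum 𝒮' hv).trans (Real.exp_le_exp.2 ?_)
    calc ∑ S ∈ 𝒮', ‖mayer supp inc w Λ S‖ ≤ ∑ x ∈ T, ∑ S ∈ 𝒮' with x ∈ S, ‖mayer supp inc w Λ S‖ := sum_le_sum_pinned 𝒮' hv T h𝒮'T
      _ ≤ ∑ _x ∈ T, η := sum_le_sum hm0
      _ = η * T.card := by rw [sum_const, nsmul_eq_mul, mul_comm]
  refine (norm_Gk_le_sum_decorated wQ inc w X').trans ?_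
  rw [mul_sum]
  refine sum_le_sum fun D hD => ?_
  have hP : 0 ≤ ∏ X ∈ D, ‖wQ X‖ := prod_nonneg fun _ _ => norm_nonneg _
  -- only the genuine points of `X′ ∖ dsupp D` are asked to be covered (an upper bound)
  have hweak : ∑ 𝒯 ∈ 𝒮'.powerset with X' \ dsupp suppQ D ⊆ 𝒯.biUnion id, ∏ S ∈ 𝒯, ‖mayer supp inc w Λ S‖ ≤
      ∑ 𝒯 ∈ 𝒮'.powerset with (X' \ dsupp suppQ D) ∩ T ⊆ 𝒯.biUnion id, ∏ S ∈ 𝒯, ‖mayer supp inc w Λ S‖ :=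
    sum_le_sum_of_subset_of_nonneg (fun 𝒯 h𝒯 => mem_filter.2 ⟨(mem_filter.1 h𝒯).1, inter_subset_left.trans (mem_filter.1 h𝒯).2⟩)
      fun 𝒯 h𝒯 _ => prod_nonneg fun S hS => hv S (mem_powerset.1 (mem_filter.1 h𝒯).1 hS)
  calc (∏ X ∈ D, ‖wQ X‖) * ∑ 𝒯 ∈ 𝒮'.powerset with X' \ dsupp suppQ D ⊆ 𝒯.biUnion id, ∏ S ∈ 𝒯, ‖mayer supp inc w Λ S‖
      ≤ (∏ X ∈ D, ‖wQ X‖) * ((∏ S ∈ 𝒮', (1 + ‖mayer supp inc w Λ S‖)) * Real.exp (-(lam * ((X' \ dsupp suppQ D) ∩ T).card))) :=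
        mul_le_mul_of_nonneg_left (hweak.trans (sum_covers_le 𝒮' hv hlam T _ inter_subset_right
          fun x hx => (hm x (mem_inter.1 hx).2).trans hη1)) hP
    _ ≤ (∏ X ∈ D, ‖wQ X‖) * (Real.exp (η * T.card) * Real.exp (-(lam * ((X' \ dsupp suppQ D) ∩ T).card))) := by gcongr
    _ = Real.exp (η * T.card) * ((∏ X ∈ D, ‖wQ X‖) * Real.exp (-(lam * ((X' \ dsupp suppQ D) ∩ T).card))) := by ring

end MayerBound

/-! ## §4 The pinned Mayer bound from a pinned bound on the clusters -/

section Clusters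

variable {ι : Type*} [DecidableEq ι] {P : Type*} [DecidableEq P] {Q : Type*} [DecidableEq Q] {σ : Type*} [DecidableEq σ]
variable {supp : P → Finset ι} {suppQ : Q → Finset ι} {obs : Q → Finset σ} {loc : σ → Finset ι} {Rset : Finset σ}
  {𝒬 : Finset Q} {Λ : Finset P}

/-- `‖Ψ(S)‖ ≤ Σ_{C ⊆ Λ: supp C = S} ‖Φ^T(C)‖`. [cite: BalabanImbrieJaffe1988, (5.14.5) p.312] -/
theorem norm_suppWeight_le (inc : P → P → Prop) [DecidableRel inc] (w : P → ℂ) (S : Finset ι) :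
    ‖suppWeight supp inc w Λ S‖ ≤ ∑ C ∈ Λ.powerset with csupp supp C = S, ‖truncatedWeight inc w C‖ :=
  norm_sum_le _ _

/-- **the Mayer factor is at most twice the cluster weight of its support**: `‖e^{−Ψ(S)} − 1‖ ≤ 2‖Ψ(S)‖` for `‖Ψ(S)‖ ≤ 1`.
[cite: BalabanImbrieJaffe1988, (5.14.5) p.312] -/
theorem norm_mayer_le (inc : P → P → Prop) [DecidableRel inc] (w : P → ℂ) {S : Finset ι} (hS : ‖suppWeight supp inc w Λ S‖ ≤ 1) :
    ‖mayer supp inc w Λ S‖ ≤ 2 * ‖suppWeight supp inc w Λ S‖ := by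
  unfold mayer
  have h := Complex.norm_exp_sub_one_le (x := -suppWeight supp inc w Λ S) (by rwa [norm_neg])
  rwa [norm_neg] at h

/-- **the pinned Mayer bound from the pinned cluster bound**: if at every point `x ∈ T` the clusters whose support passes through `x` satisfy
`Σ_{C⊆Λ: x∈supp C} ‖Φ^T(C)‖ e^{λ#(supp C ∩ T)} ≤ η/2` with `η ≤ 1` (`λ ≥ 0`), then `Σ_{S ⊆ X′, S∋x} ‖m(S)‖ e^{λ#(S∩T)} ≤ η` — the hypothesis of
`norm_Gk_le_of_mayer_bound`. [cite: BalabanImbrieJaffe1988, (5.14.5) p.312] -/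
theorem mayer_pinned_bound_of_clusters (inc : P → P → Prop) [DecidableRel inc] (w : P → ℂ) (X' T : Finset ι) {lam η : ℝ} (hlam : 0 ≤ lam)
    (hη1 : η ≤ 1)
    (hΦ : ∀ x ∈ T, ∑ C ∈ Λ.powerset with x ∈ csupp supp C,
      ‖truncatedWeight inc w C‖ * Real.exp (lam * (csupp supp C ∩ T).card) ≤ η / 2) {x : ι} (hx : x ∈ T) :
    ∑ S ∈ ((suppSets supp Λ).filter fun S => S ⊆ X') with x ∈ S, ‖mayer supp inc w Λ S‖ * Real.exp (lam * (S ∩ T).card) ≤ η := by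
  set F : Finset P → ℝ := fun C => ‖truncatedWeight inc w C‖ * Real.exp (lam * (csupp supp C ∩ T).card) with hF
  have hF0 : ∀ C, 0 ≤ F C := fun C => mul_nonneg (norm_nonneg _) (Real.exp_nonneg _)
  set t : Finset (Finset ι) := ((suppSets supp Λ).filter fun S => S ⊆ X').filter fun S => x ∈ S with ht
  -- the clusters with support `S ∋ x` form disjoint parts of the clusters through `x`
  set fiber : Finset ι → Finset (Finset P) := fun S => Λ.powerset.filter fun C => csupp supp C = S with hfiber
  have hdisj : (t : Set (Finset ι)).PairwiseDisjoint fiber := by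
    intro S _ S' _ hne
    refine disjoint_left.2 fun C hC hC' => hne ?_
    rw [← (mem_filter.1 hC).2, ← (mem_filter.1 hC').2]
  have hsub : t.biUnion fiber ⊆ Λ.powerset.filter fun C => x ∈ csupp supp C := by
    intro C hC
    obtain ⟨S, hS, hCS⟩ := mem_biUnion.1 hC
    obtain ⟨hCΛ, hCS⟩ := mem_filter.1 hCS
    exact mem_filter.2 ⟨hCΛ, hCS ▸ (mem_filter.1 hS).2⟩
  -- each cluster weight `‖Ψ(S)‖ ≤ Σ_{fiber S} F ≤ η/2 ≤ 1`
  have hΨF : ∀ S ∈ t, ‖suppWeight supp inc w Λ S‖ * Real.exp (lam * (S ∩ T).card) ≤ ∑ C ∈ fiber S, F C := by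
    intro S hS
    rw [sum_congr rfl fun C hC => show F C = ‖truncatedWeight inc w C‖ * Real.exp (lam * (S ∩ T).card) by
      rw [hF]; simp only; rw [(mem_filter.1 hC).2], ← sum_mul]
    exact mul_le_mul_of_nonneg_right (norm_suppWeight_le inc w S) (Real.exp_nonneg _)
  have hfib_le : ∀ S ∈ t, ∑ C ∈ fiber S, F C ≤ η / 2 := by
    intro S hS
    calc ∑ C ∈ fiber S, F C = ∑ C ∈ ({S} : Finset (Finset ι)).biUnion fiber, F C := by rw [singleton_biUnion]
      _ ≤ ∑ C ∈ t.biUnion fiber, F C :=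
          sum_le_sum_of_subset_of_nonneg (biUnion_subset_biUnion_of_subset_left fiber (singleton_subset_iff.2 hS)) fun C _ _ => hF0 C
      _ ≤ ∑ C ∈ Λ.powerset with x ∈ csupp supp C, F C := sum_le_sum_of_subset_of_nonneg hsub fun C _ _ => hF0 C
      _ ≤ η / 2 := hΦ x hx
  have hΨ1 : ∀ S ∈ t, ‖suppWeight supp inc w Λ S‖ ≤ 1 := by
    intro S hS
    have h1 : ‖suppWeight supp inc w Λ S‖ ≤ ‖suppWeight supp inc w Λ S‖ * Real.exp (lam * (S ∩ T).card) :=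
      le_mul_of_one_le_right (norm_nonneg _) (Real.one_le_exp (mul_nonneg hlam (Nat.cast_nonneg _)))
    linarith [hΨF S hS, hfib_le S hS]
  calc ∑ S ∈ t, ‖mayer supp inc w Λ S‖ * Real.exp (lam * (S ∩ T).card)
      ≤ ∑ S ∈ t, 2 * (‖suppWeight supp inc w Λ S‖ * Real.exp (lam * (S ∩ T).card)) := by
        refine sum_le_sum fun S hS => ?_
        rw [← mul_assoc]
        exact mul_le_mul_of_nonneg_right (norm_mayer_le inc w (hΨ1 S hS)) (Real.exp_nonneg _)
    _ ≤ ∑ S ∈ t, 2 * ∑ C ∈ fiber S, F C := sum_le_sum fun S hS => by linarith [hΨF S hS]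
    _ = 2 * ∑ C ∈ t.biUnion fiber, F C := by rw [← mul_sum, sum_biUnion hdisj]
    _ ≤ 2 * ∑ C ∈ Λ.powerset with x ∈ csupp supp C, F C :=
        mul_le_mul_of_nonneg_left (sum_le_sum_of_subset_of_nonneg hsub fun C _ _ => hF0 C) (by norm_num)
    _ ≤ 2 * (η / 2) := mul_le_mul_of_nonneg_left (hΦ x hx) (by norm_num)
    _ = η := by ring

/-- **THE GAS-LEVEL ESTIMATE FROM A PINNED CLUSTER BOUND**: `|G_k(X′)| ≤ e^{η#T} Σ_D (Π_{X∈D}‖wQ X‖) e^{−λ#((X′∖dsupp D)∩T)}` whenever every Mayer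
support set inside `X′` meets `T` and `Σ_{C⊆Λ: x∈supp C} ‖Φ^T(C)‖ e^{λ#(supp C∩T)} ≤ η/2 ≤ 1/2` at every point of `T`.
[cite: BalabanImbrieJaffe1988, (5.14.5) p.312] -/
theorem norm_Gk_le_of_cluster_bound (wQ : Q → ℂ) (inc : P → P → Prop) [DecidableRel inc] (w : P → ℂ) (X' T : Finset ι) {lam η : ℝ}
    (hlam : 0 ≤ lam) (hη1 : η ≤ 1) (hT : ∀ S ∈ suppSets supp Λ, S ⊆ X' → (S ∩ T).Nonempty)
    (hΦ : ∀ x ∈ T, ∑ C ∈ Λ.powerset with x ∈ csupp supp C,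
      ‖truncatedWeight inc w C‖ * Real.exp (lam * (csupp supp C ∩ T).card) ≤ η / 2) :
    ‖Gk supp suppQ obs loc Rset 𝒬 wQ inc w Λ X'‖ ≤
      Real.exp (η * T.card) *
        ∑ D ∈ 𝒬.powerset with ((∀ X ∈ D, ∀ X₂ ∈ D, X ≠ X₂ → Disjoint (suppQ X) (suppQ X₂)) ∧ D.biUnion obs = obsIn loc Rset X' ∧
            dsupp suppQ D ⊆ X'),
          (∏ X ∈ D, ‖wQ X‖) * Real.exp (-(lam * ((X' \ dsupp suppQ D) ∩ T).card)) :=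
  norm_Gk_le_of_mayer_bound wQ inc w X' T hlam hη1 hT fun _ hx => mayer_pinned_bound_of_clusters inc w X' T hlam hη1 hΦ hx

end Clusters

/-! ## §5 The pinned cluster bound from the Kotecký–Preiss estimate (4), and the end-to-end gas-level estimate -/

section KP

variable {ι : Type*} [DecidableEq ι] {P : Type*} [DecidableEq P] {Q : Type*} [DecidableEq Q] {σ : Type*} [DecidableEq σ]
variable {supp : P → Finset ι} {suppQ : Q → Finset ι} {obs : Q → Finset σ} {loc : σ → Finset ι} {Rset : Finset σ}
  {𝒬 : Finset Q} {Λ : Finset P}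

/-- **THE PINNED CLUSTER BOUND FROM THE KOTECKÝ–PREISS ESTIMATE** ([KP86] Theorem p. 492, estimate (4) — the tree's discharged named fact
`koteckyPreiss_truncatedWeight_bound_holds`): if the activities of the volume `Λ` satisfy the KP hypothesis (1) `Σ_{γ'∈Λ, γ' ι γ} ‖w γ'‖ e^{a(γ')+d(γ')}
≤ a(γ)` for EVERY polymer `γ` (size functions `a, d ≥ 0`, `d ≥ λ·#(supp ∩ T)` on `Λ`), and `σ₀` is a *pinning polymer at the point `x`* (every polymer
of `Λ` whose support contains `x` is incompatible with `σ₀`), then `Σ_{C⊆Λ: x∈supp C} ‖Φ^T(C)‖ e^{λ#(supp C∩T)} ≤ a(σ₀)`.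
[cite: BalabanImbrieJaffe1988, (5.14.5) p.312] -/
theorem cluster_pinned_bound_of_kp [Fintype P] {inc : P → P → Prop} [DecidableRel inc] [Std.Refl inc] [Std.Symm inc] {w : P → ℂ}
    {a d : P → ℝ} (ha : ∀ γ, 0 ≤ a γ) (hd : ∀ γ, 0 ≤ d γ) {lam : ℝ} (hlam : 0 ≤ lam) (T : Finset ι)
    (hdlam : ∀ Y ∈ Λ, lam * (supp Y ∩ T).card ≤ d Y)
    (hKP1 : ∀ γ : P, ∑ γ' ∈ Λ with inc γ' γ, ‖w γ'‖ * Real.exp (a γ' + d γ') ≤ a γ)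
    {x : ι} {σ₀ : P} (hσ : ∀ Y ∈ Λ, x ∈ supp Y → inc Y σ₀) :
    ∑ C ∈ Λ.powerset with x ∈ csupp supp C, ‖truncatedWeight inc w C‖ * Real.exp (lam * (csupp supp C ∩ T).card) ≤ a σ₀ := by
  classical
  -- the activity restricted to the volume
  set wΛ : P → ℂ := fun Y => if Y ∈ Λ then w Y else 0 with hwΛ
  have hfact := koteckyPreiss_truncatedWeight_bound_holds inc wΛ a d
  have h1 := kp_hypothesis_of_fintype (inc := inc) (w := wΛ) (a := a) (d := d) fun γ => by
    calc ∑ γ' ∈ univ with inc γ' γ, ‖wΛ γ'‖ * Real.exp (a γ' + d γ')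
        = ∑ γ' ∈ univ with inc γ' γ, if γ' ∈ Λ then ‖w γ'‖ * Real.exp (a γ' + d γ') else 0 :=
          sum_congr rfl fun γ' _ => by by_cases h : γ' ∈ Λ <;> simp [hwΛ, h]
      _ = ∑ γ' ∈ (univ.filter fun γ' => inc γ' γ) with γ' ∈ Λ, ‖w γ'‖ * Real.exp (a γ' + d γ') := (sum_filter _ _).symm
      _ = ∑ γ' ∈ Λ with inc γ' γ, ‖w γ'‖ * Real.exp (a γ' + d γ') := by
          refine sum_congr ?_ fun _ _ => rfl
          ext γ'
          simp only [mem_filter, mem_univ, true_and]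
          tauto
      _ ≤ a γ := hKP1 γ
  set 𝒞 : Finset (Finset P) := Λ.powerset.filter fun C => x ∈ csupp supp C with h𝒞
  have hKP4 := sum_norm_truncatedWeight_mul_exp_le_of_touches hfact ha hd h1 𝒞 σ₀
  -- every cluster through `x` touches the pinning polymer
  have htouch : ∀ C ∈ 𝒞, KPTouches inc C σ₀ := by
    intro C hC
    obtain ⟨hCΛ, hxC⟩ := mem_filter.1 hC
    obtain ⟨Y, hY, hxY⟩ := mem_csupp.1 hxC
    exact ⟨Y, hY, hσ Y (mem_powerset.1 hCΛ hY) hxY⟩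
  rw [filter_true_of_mem htouch] at hKP4
  refine le_trans (sum_le_sum fun C hC => ?_) hKP4
  have hCΛ : C ⊆ Λ := mem_powerset.1 (mem_filter.1 hC).1
  rw [truncatedWeight_congr (inc := inc) (w := wΛ) (w' := w) fun γ hγ => by rw [hwΛ]; simp [hCΛ hγ]]
  refine mul_le_mul_of_nonneg_left (Real.exp_le_exp.2 ?_) (norm_nonneg _)
  calc lam * ((csupp supp C ∩ T).card : ℝ) ≤ lam * ∑ Y ∈ C, ((supp Y ∩ T).card : ℝ) := by
        refine mul_le_mul_of_nonneg_left ?_ hlam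
        have h : csupp supp C ∩ T = C.biUnion fun Y => supp Y ∩ T := by unfold csupp; rw [biUnion_inter]
        rw [h]
        exact_mod_cast card_biUnion_le
    _ = ∑ Y ∈ C, lam * (supp Y ∩ T).card := by rw [mul_sum]
    _ ≤ ∑ Y ∈ C, d Y := sum_le_sum fun Y hY => hdlam Y (hCΛ hY)

/-- **THE p. 312 ESTIMATE OF `G_k` AT GAS LEVEL, END TO END FROM THE KOTECKÝ–PREISS CONDITION**: for a vacuum gas on the volume `Λ` satisfying
the KP hypothesis (1) for all polymers with size functions `a, d ≥ 0`, `d ≥ λ·#(supp ∩ T)` (`λ ≥ 0`, `T` a set of genuine points met by every Mayer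
support set inside `X′`), and a pinning polymer `σ_x` with `a(σ_x) ≤ η/2` (`η ≤ 1`) at every point `x ∈ T`:
`‖G_k(X′)‖ ≤ e^{η#T} · Σ_{D admissible decorated families in X′} (Π_{X∈D}‖wQ X‖) · e^{−λ#((X′ ∖ dsupp D) ∩ T)}` — the printed shape
`c(F(X))·θ^{β′|X∖∪X_c|}·(combinatoric factor)`, with the observable activities `‖wQ X‖` as displayed inputs (the printed `c(L^kε)^{−m(c)}e^{−m′(c)}`
and the small factors from the integrations by parts are NOT modelled). [cite: BalabanImbrieJaffe1988, (5.14.5) p.312] -/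
theorem norm_Gk_le_of_kp [Fintype P] (wQ : Q → ℂ) {inc : P → P → Prop} [DecidableRel inc] [Std.Refl inc] [Std.Symm inc] {w : P → ℂ}
    {a d : P → ℝ} (ha : ∀ γ, 0 ≤ a γ) (hd : ∀ γ, 0 ≤ d γ) {lam η : ℝ} (hlam : 0 ≤ lam) (hη1 : η ≤ 1) (X' T : Finset ι)
    (hT : ∀ S ∈ suppSets supp Λ, S ⊆ X' → (S ∩ T).Nonempty) (hdlam : ∀ Y ∈ Λ, lam * (supp Y ∩ T).card ≤ d Y)
    (hKP1 : ∀ γ : P, ∑ γ' ∈ Λ with inc γ' γ, ‖w γ'‖ * Real.exp (a γ' + d γ') ≤ a γ)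
    (hpin : ∀ x ∈ T, ∃ σ₀ : P, a σ₀ ≤ η / 2 ∧ ∀ Y ∈ Λ, x ∈ supp Y → inc Y σ₀) :
    ‖Gk supp suppQ obs loc Rset 𝒬 wQ inc w Λ X'‖ ≤
      Real.exp (η * T.card) *
        ∑ D ∈ 𝒬.powerset with ((∀ X ∈ D, ∀ X₂ ∈ D, X ≠ X₂ → Disjoint (suppQ X) (suppQ X₂)) ∧ D.biUnion obs = obsIn loc Rset X' ∧
            dsupp suppQ D ⊆ X'),
          (∏ X ∈ D, ‖wQ X‖) * Real.exp (-(lam * ((X' \ dsupp suppQ D) ∩ T).card)) := by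
  refine norm_Gk_le_of_cluster_bound wQ inc w X' T hlam hη1 hT fun x hx => ?_
  obtain ⟨σ₀, hσa, hσ⟩ := hpin x hx
  exact (cluster_pinned_bound_of_kp ha hd hlam T hdlam hKP1 hσ).trans hσa

end KP

end Literature.MathematicalPhysics.QuantumFieldTheory.BalabanImbrieJaffe1984to88.BIJ88GkEstimate312
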